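import Mathlib.Topology.Order.Basic
import Mathlib.Topology.Instances.Real.Lemmas
import Mathlib.Order.Fin.Basic
import HarnessLib

/-!
# Finite partitions of an interval: pieces and covers

Topic: infrastructure for pasting piecewise-defined homotopies over a finite partition
`θ₀ < θ₁ < ⋯ < θ_N` of an interval (plan (d) F4 of the fact seat: the plaque-wise interpolation
between the lift of the boundary loop and the image of the contour leaf of the coned collar is
defined square by square between consecutive crossing parameters). For a strictly increasing
`θs : Fin (N + 1) → ℝ` with `0 < N`: every point of `[θs 0, θs (Fin.last N)]` lies in some closed
piece `[θs j.castSucc, θs j.succ]` (`exists_piece`), the pieces cover the interval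
(`iUnion_piece_eq`), two pieces meet only at a common end point (`eq_or_eq_of_mem_piece_of_mem_piece`),
and a function defined piece by piece from continuous functions agreeing at the common end points
is continuous on the interval (`continuousOn_piecewise`).

* `Partition.piece`, `Partition.exists_piece`, `Partition.iUnion_piece_eq`,
  `Partition.mem_piece_mem_piece`, `Partition.continuousOn_of_pieces` (**proved**).

All statements are [folklore].
-/

noncomputable section

open Set Filter Function
open scoped Topology

namespace Literature.Topology.FourManifolds

namespace Partition

variable {N : ℕ} {θs : Fin (N + 1) → ℝ}

/-- The `j`-th closed piece `[θs j, θs (j+1)]`. [folklore] -/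
def piece (θs : Fin (N + 1) → ℝ) (j : Fin N) : Set ℝ := Icc (θs (Fin.castSucc j)) (θs j.succ)

/-- **Every point of the interval lies in some piece** (`0 < N`). [folklore] -/
theorem exists_piece (hmono : StrictMono θs) (hN : 0 < N) {θ : ℝ} (hθ : θ ∈ Icc (θs 0) (θs (Fin.last N))) :
    ∃ j : Fin N, θ ∈ piece θs j := by
  classical
  -- the largest index `i` with `θs i ≤ θ`
  set S : Finset (Fin (N + 1)) := Finset.univ.filter fun i ↦ θs i ≤ θ with hS
  have hSne : S.Nonempty := ⟨0, by simp [hS, hθ.1]⟩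
  set i := S.max' hSne with hi
  have hiS : i ∈ S := S.max'_mem hSne
  have hile : θs i ≤ θ := by simpa [hS] using hiS
  have hmax : ∀ i', θs i' ≤ θ → i' ≤ i := fun i' h ↦ S.le_max' i' (by simp [hS, h])
  by_cases hlast : i = Fin.last N
  · -- `θ = θs last`: the last piece
    have hθeq : θ = θs (Fin.last N) := le_antisymm hθ.2 (by rw [← hlast]; exact hile)
    refine ⟨⟨N - 1, by omega⟩, ?_⟩
    have hsucc : (⟨N - 1, by omega⟩ : Fin N).succ = Fin.last N := by
      ext; simp; omega
    refine ⟨?_, by rw [hsucc]; exact hθeq.le⟩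
    exact (hmono.monotone (Fin.le_last _)).trans hθeq.ge
  · -- `i < last`: the piece `[θs i, θs (i+1)]`
    have hilt : (i : ℕ) < N := by
      have := Fin.val_lt_last hlast
      simpa using this
    refine ⟨⟨i, hilt⟩, ?_⟩
    have hcast : Fin.castSucc (⟨i, hilt⟩ : Fin N) = i := by ext; rfl
    refine ⟨by rw [hcast]; exact hile, ?_⟩
    -- `θ < θs (i+1)` since `i+1 ∉ S`
    by_contra hlt
    push Not at hlt
    have hmem : θs (⟨i, hilt⟩ : Fin N).succ ≤ θ := hlt.le
    have h := hmax _ hmem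
    have : ((⟨i, hilt⟩ : Fin N).succ : ℕ) ≤ (i : ℕ) := h
    simp at this

/-- **The pieces cover the interval** (`0 < N`). [folklore] -/
theorem iUnion_piece_eq (hmono : StrictMono θs) (hN : 0 < N) :
    (⋃ j : Fin N, piece θs j) = Icc (θs 0) (θs (Fin.last N)) := by
  apply Subset.antisymm
  · refine iUnion_subset fun j θ hθ ↦ ⟨?_, ?_⟩
    · exact (hmono.monotone (Fin.zero_le _)).trans hθ.1
    · exact hθ.2.trans (hmono.monotone (Fin.le_last _))
  · intro θ hθ
    obtain ⟨j, hj⟩ := exists_piece hmono hN hθ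
    exact mem_iUnion.2 ⟨j, hj⟩

/-- **Two different pieces meet only at a common end point**: if `θ` lies in the pieces `j < j'`
then `j' = j + 1` and `θ = θs j' = θs (j+1)`. [folklore] -/
theorem mem_piece_mem_piece (hmono : StrictMono θs) {j j' : Fin N} (hjj' : j < j') {θ : ℝ} (hj : θ ∈ piece θs j)
    (hj' : θ ∈ piece θs j') : θ = θs j.succ ∧ θ = θs (Fin.castSucc j') := by
  -- `θs j.succ ≤ θs j'.castSucc` as `j + 1 ≤ j'`
  have hle : θs j.succ ≤ θs (Fin.castSucc j') := by
    apply hmono.monotone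
    show (j : ℕ) + 1 ≤ (j' : ℕ)
    exact hjj'
  have h1 : θ ≤ θs j.succ := hj.2
  have h2 : θs (Fin.castSucc j') ≤ θ := hj'.1
  exact ⟨le_antisymm h1 (hle.trans h2), le_antisymm (h1.trans hle) h2⟩

/-- **Pasting continuous functions on the pieces.** If `f` agrees on each piece with a function
continuous on that piece, then `f` is continuous on the interval. [folklore] -/
theorem continuousOn_of_pieces {Y : Type*} [TopologicalSpace Y] (hmono : StrictMono θs) (hN : 0 < N) {f : ℝ → Y}
    (hf : ∀ j : Fin N, ∃ g : ℝ → Y, ContinuousOn g (piece θs j) ∧ ∀ θ ∈ piece θs j, f θ = g θ) :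
    ContinuousOn f (Icc (θs 0) (θs (Fin.last N))) := by
  rw [← iUnion_piece_eq hmono hN]
  refine LocallyFinite.continuousOn_iUnion (locallyFinite_of_finite _) (fun j ↦ isClosed_Icc) fun j ↦ ?_
  obtain ⟨g, hg, hfg⟩ := hf j
  exact hg.congr hfg

/-- **Pasting in two variables**: a function on `X × ℝ` which agrees on each `X × piece j` with a
function continuous there is continuous on `X × [θs 0, θs last]`. [folklore] -/
theorem continuousOn_prod_of_pieces {X Y : Type*} [TopologicalSpace X] [TopologicalSpace Y] (hmono : StrictMono θs) (hN : 0 < N)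
    {S : Set X} (hS : IsClosed S) {f : X × ℝ → Y}
    (hf : ∀ j : Fin N, ∃ g : X × ℝ → Y, ContinuousOn g (S ×ˢ piece θs j) ∧ ∀ p ∈ S ×ˢ piece θs j, f p = g p) :
    ContinuousOn f (S ×ˢ Icc (θs 0) (θs (Fin.last N))) := by
  have heq : S ×ˢ Icc (θs 0) (θs (Fin.last N)) = ⋃ j : Fin N, S ×ˢ piece θs j := by
    rw [← iUnion_piece_eq hmono hN, prod_iUnion]
  rw [heq]
  refine LocallyFinite.continuousOn_iUnion (locallyFinite_of_finite _) (fun j ↦ hS.prod isClosed_Icc) fun j ↦ ?_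
  obtain ⟨g, hg, hfg⟩ := hf j
  exact hg.congr hfg

/-- The local parameter of a piece, rescaled to `[0, 1]`: `(θ - θs j) / (θs (j+1) - θs j)`.
[folklore] -/
def rescale (θs : Fin (N + 1) → ℝ) (j : Fin N) (θ : ℝ) : ℝ := (θ - θs (Fin.castSucc j)) / (θs j.succ - θs (Fin.castSucc j))

/-- The rescaled parameter is continuous. [folklore] -/
theorem continuous_rescale (j : Fin N) : Continuous (rescale θs j) :=
  (continuous_id.sub continuous_const).div_const _

/-- On the piece the rescaled parameter is in `[0, 1]`. [folklore] -/
theorem rescale_mem (hmono : StrictMono θs) (j : Fin N) {θ : ℝ} (hθ : θ ∈ piece θs j) : rescale θs j θ ∈ Icc (0 : ℝ) 1 := by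
  have hlt : θs (Fin.castSucc j) < θs j.succ := hmono (Fin.castSucc_lt_succ (i := j))
  unfold rescale
  constructor
  · exact div_nonneg (by linarith [hθ.1]) (by linarith)
  · rw [div_le_one (by linarith)]; linarith [hθ.2]

/-- At the left end the rescaled parameter is `0`. [folklore] -/
theorem rescale_left (j : Fin N) : rescale θs j (θs (Fin.castSucc j)) = 0 := by simp [rescale]

/-- At the right end the rescaled parameter is `1`. [folklore] -/
theorem rescale_right (hmono : StrictMono θs) (j : Fin N) : rescale θs j (θs j.succ) = 1 := by
  have hlt : θs (Fin.castSucc j) < θs j.succ := hmono (Fin.castSucc_lt_succ (i := j))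
  unfold rescale
  exact div_self (by linarith)

end Partition

end Literature.Topology.FourManifolds
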